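import Summits.AtomisticToContinuum.Crystallization.Theorems.ChargedEnergyGapNearFarSplit
import Summits.AtomisticToContinuum.Crystallization.Theorems.ChargedEnergyGapSharpTail
import HarnessLib

/-!
# Charged energy gap — lens-3 g63, part P-Z₃: SELF-CHARGING of the far residue — only BULK sources remain

Cell `decomp-a2c`, seat lens-3, generation 63, part P-Z₃ (after P-Y `ChargedEnergyGapNearFarSplit` and P-Z₂ `ChargedEnergyGapSharpTail`).
ELEMENTARY·PROVED.  P-Y reduced the rotation sub-family of (H𝄪ˢ) to the far-residue bound `FarResidueBound s lam ℓ ϱ ϱχ A_T A_χ A_H`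
(`farResidue ≤ A_T·shellMassL + A_χ·transMassL + A_H·pricedNearCountL`, record `(A_T, A_χ) = (1/1350, 1/45)`, `A_H` free).  The far residue is
a SOURCE sum `Σ_{y ∈ motif ∖ X} χ_σ(y)·w_C(y)·E_{X ∖ near}(y)`, and a source of positive weight sees the far excised sites only beyond `3ϱ/8`, so
by P-Z₂ its tension sum is `≤ κ := (2h/s+2)(2/s)²((R+h+s/2)/R)²(3/R⁴+1/(hR³))`, `R = 3ϱ/8` (record: `≤ 1/3800`).  Here the sources are sorted:
* `weight_le_shell_add_trans_add_bulk` — pointwise `χ·w ≤ [0 < w < 1]·χ + w·alive·mult² + [w = 1 ∧ mult = 0]·χ`: a source in the profile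
  shell is a shell carrier of mass `χ ≥ χw`; a source with a listed set in transition is a transition carrier of mass `w·alive·mult² ≥ χw`
  (`χ ≤ alive`, P-U `localFactor_le_aliveFactor`); the rest are BULK sources (`w = 1`, no transition; there `χ ∈ {0, 1}`,
  `localFactor_eq_zero_or_one_of_transMult_eq_zero`);
* ★★ `farResidue_le_selfCharge` — `farResidue ≤ κ·(shellMassL + transMassL) + bulkFarResidue` for every `s`-separated reference
  (`0 < s ≤ 3ϱ/8`, `1 ≤ 3ϱ/8`) and every shell thickness `h > 0`; `farResidue_le_selfCharge_record` — at `s = 3/5`, `ϱ = 160`: `κ ≤ 1/3800`;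
* `BulkFarResidueBound` — the residual statement for the bulk sources alone; ★★ `farResidueBound_of_bulk` — `BulkFarResidueBound … B_T B_χ B_H
  ⟹ FarResidueBound … (B_T + κ) (B_χ + κ) B_H`; ★ `rotationFamilyS_record_of_bulkBound` — at the record, `BulkFarResidueBound (3/5) (1/3) 3 160 80
  (1/2100) (1/46) B_H` (any `B_H ≥ 0`) gives the rotation sub-family of (H𝄪ˢ) (`1/2100 + 1/3800 ≤ 1/1350`, `1/46 + 1/3800 ≤ 1/45`).
So the attribution problem of the far residue (critic row 1178 (d1)) is now confined to BULK sources — sites deep inside the paying region whose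
segment to a far excised site must cross a boundary layer of the paying region (seat HANDOFF §E (B)).
-/

noncomputable section

open scoped Classical

open Literature.MathematicalPhysics.StatisticalMechanics Literature.Geometry.DiscreteGeometry
open Summit.AtomisticToContinuum.Crystallization.Theses.PricedLinkCensus
open Summit.AtomisticToContinuum.Crystallization.Theorems.ChargedEnergyGapNegative

namespace Summit.AtomisticToContinuum.Crystallization.Theorems.ChargedEnergyGapChartDial

section SelfCharge

variable (ϱχ : ℝ) {m : ℕ} (D : Fin m → Set E3) (σ : Fin m → Bool) (P : PeriodicConfiguration 3) (X : Set E3) (ϱ : ℝ) (C : Set E3)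

/-- The **BULK FAR RESIDUE**: the part of the far residue emitted by the BULK sources — non-excised motif sites of profile weight exactly `1`
with no listed set in transition (`Σ_{y bulk} χ_σ(y)·E_{X ∖ near}(y)`). -/
def bulkFarResidue : ℝ :=
  ∑ y ∈ P.motif, if y ∉ X ∧ profileWeight ϱ C y = 1 ∧ transMult ϱχ D y = 0 then
    localFactor ϱχ D σ y * excisionSum P (X \ nearZone ϱχ D σ P X ϱ C) y else 0

/-- `bulkFarResidue_nonneg`. [formal bookkeeping] -/
theorem bulkFarResidue_nonneg : 0 ≤ bulkFarResidue ϱχ D σ P X ϱ C :=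
  Finset.sum_nonneg fun y _ => by
    split_ifs
    · exact mul_nonneg (localFactor_nonneg (ϱχ := ϱχ) (D := D) (σ := σ) y) (excisionSum_nonneg P _ y)
    · exact le_rfl

variable {ϱχ D σ}

/-- A factor NOT in transition is `0` or `1`. -/
theorem factor_eq_zero_or_one_of_not_inTransition {i : Fin m} {y : E3} (h : ¬ InTransition ϱχ D i y) :
    (if σ i then profileWeight ϱχ (D i) y else 1 - profileWeight ϱχ (D i) y) = 0 ∨
      (if σ i then profileWeight ϱχ (D i) y else 1 - profileWeight ϱχ (D i) y) = 1 := by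
  have h0 := profileWeight_nonneg ϱχ (D i) y
  have h1 := profileWeight_le_one ϱχ (D i) y
  have hw : profileWeight ϱχ (D i) y = 0 ∨ profileWeight ϱχ (D i) y = 1 := by
    unfold InTransition at h
    by_cases hz : profileWeight ϱχ (D i) y = 0
    · exact Or.inl hz
    · right
      have hpos : 0 < profileWeight ϱχ (D i) y := lt_of_le_of_ne h0 (Ne.symm hz)
      by_contra hne
      exact h ⟨hpos, lt_of_le_of_ne h1 hne⟩
  cases hσ : σ i
  · rcases hw with hw | hw
    · right; simp [hw]
    · left; simp [hw]
  · rcases hw with hw | hw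
    · left; simpa using hw
    · right; simpa using hw

/-- ★ A site with NO listed set in transition has localisation factor `0` or `1` (bulk sources pay with weight exactly `χ·w ∈ {0, 1}`). -/
theorem localFactor_eq_zero_or_one_of_transMult_eq_zero {y : E3} (h : transMult ϱχ D y = 0) :
    localFactor ϱχ D σ y = 0 ∨ localFactor ϱχ D σ y = 1 := by
  have hnot : ∀ i, ¬ InTransition ϱχ D i y := by
    intro i hi
    unfold transMult at h
    rw [Finset.card_eq_zero, Finset.filter_eq_empty_iff] at h
    exact h (Finset.mem_univ i) hi
  unfold localFactor
  by_cases hz : ∃ i, (if σ i then profileWeight ϱχ (D i) y else 1 - profileWeight ϱχ (D i) y) = 0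
  · obtain ⟨i, hi⟩ := hz
    exact Or.inl (Finset.prod_eq_zero (Finset.mem_univ i) hi)
  · push Not at hz
    exact Or.inr (Finset.prod_eq_one fun i _ => (factor_eq_zero_or_one_of_not_inTransition (σ := σ) (hnot i)).resolve_left (hz i))

/-- ★ **THE POINTWISE SORTING OF SOURCES**: `χ·w ≤ [0 < w < 1]·χ + w·alive·mult² + [w = 1 ∧ mult = 0]·χ` — shell carrier, transition carrier,
or bulk. -/
theorem weight_le_shell_add_trans_add_bulk (y : E3) :
    localFactor ϱχ D σ y * profileWeight ϱ C y ≤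
      (if 0 < profileWeight ϱ C y ∧ profileWeight ϱ C y < 1 then localFactor ϱχ D σ y else 0) +
        profileWeight ϱ C y * aliveFactor ϱχ D σ y * (transMult ϱχ D y : ℝ) ^ 2 +
        (if profileWeight ϱ C y = 1 ∧ transMult ϱχ D y = 0 then localFactor ϱχ D σ y else 0) := by
  have hχ0 := localFactor_nonneg (ϱχ := ϱχ) (D := D) (σ := σ) y
  have hχa := localFactor_le_aliveFactor (ϱχ := ϱχ) (D := D) (σ := σ) y
  have ha0 := aliveFactor_nonneg (ϱχ := ϱχ) (D := D) (σ := σ) y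
  have hw0 := profileWeight_nonneg ϱ C y
  have hw1 := profileWeight_le_one ϱ C y
  have hT : 0 ≤ profileWeight ϱ C y * aliveFactor ϱχ D σ y * (transMult ϱχ D y : ℝ) ^ 2 := by positivity
  by_cases hz : profileWeight ϱ C y = 0
  · rw [hz, mul_zero]
    have h1 : 0 ≤ (if 0 < (0 : ℝ) ∧ (0 : ℝ) < 1 then localFactor ϱχ D σ y else 0) := by simp
    have h2 : 0 ≤ (if (0 : ℝ) = 1 ∧ transMult ϱχ D y = 0 then localFactor ϱχ D σ y else 0) := by norm_num
    rw [hz] at hT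
    linarith
  have hpos : 0 < profileWeight ϱ C y := lt_of_le_of_ne hw0 (Ne.symm hz)
  by_cases hlt : profileWeight ϱ C y < 1
  · rw [if_pos ⟨hpos, hlt⟩, if_neg (fun h => absurd h.1 hlt.ne)]
    nlinarith
  have hone : profileWeight ϱ C y = 1 := le_antisymm hw1 (not_lt.1 hlt)
  rw [hone, mul_one, one_mul, if_neg (fun h => absurd h.2 (lt_irrefl _))]
  by_cases hm : transMult ϱχ D y = 0
  · rw [if_pos ⟨rfl, hm⟩, hm]
    simp
  · rw [if_neg (fun h => hm h.2)]
    have hm1 : (1 : ℝ) ≤ (transMult ϱχ D y : ℝ) := by exact_mod_cast Nat.one_le_iff_ne_zero.2 hm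
    have hle : aliveFactor ϱχ D σ y ≤ aliveFactor ϱχ D σ y * (transMult ϱχ D y : ℝ) ^ 2 :=
      le_mul_of_one_le_right ha0 (by nlinarith)
    linarith

end SelfCharge

section SelfChargeMain

variable {ϱχ : ℝ} {m : ℕ} {D : Fin m → Set E3} {σ : Fin m → Bool}

/-- A far excised site (outside the near zone) is at distance `≥ 3ϱ/8` from every non-excised site of positive localised weight. -/
theorem le_dist_of_not_mem_nearZone {P : PeriodicConfiguration 3} {X : Set E3} {ϱ : ℝ} {C : Set E3} {y z : E3} (hy : y ∈ P.points)
    (hyX : y ∉ X) (hpos : 0 < localFactor ϱχ D σ y * profileWeight ϱ C y) (hz : z ∉ nearZone ϱχ D σ P X ϱ C) : 3 * ϱ / 8 ≤ dist y z := by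
  by_contra h
  rw [dist_comm] at h
  exact hz ⟨y, hy, hyX, hpos, not_le.1 h⟩

/-- ★ The far tension sum of a POSITIVE source is at most the sharp tail constant at `R = 3ϱ/8` (P-Z₂ `excisionSum_le_farAll_sharp`). -/
theorem excisionSum_far_le_sharp {P : PeriodicConfiguration 3} {X : Set E3} {ϱ : ℝ} {C : Set E3} {s : ℝ} (hP : IsSeparatedRef s P)
    (hs : 0 < s) (hϱ1 : 1 ≤ 3 * ϱ / 8) (hsϱ : s ≤ 3 * ϱ / 8) {h : ℝ} (hh : 0 < h) {y : E3} (hy : y ∈ P.points) (hyX : y ∉ X)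
    (hpos : 0 < localFactor ϱχ D σ y * profileWeight ϱ C y) :
    excisionSum P (X \ nearZone ϱχ D σ P X ϱ C) y ≤
      (2 * h / s + 2) * (2 / s) ^ 2 * ((3 * ϱ / 8 + h + s / 2) / (3 * ϱ / 8)) ^ 2 * (3 / (3 * ϱ / 8) ^ 4 + 1 / (h * (3 * ϱ / 8) ^ 3)) :=
  excisionSum_le_farAll_sharp P _ y hP hs hh hsϱ hϱ1
    (fun _ _ hz _ => le_dist_of_not_mem_nearZone hy hyX hpos hz.2)

variable (ϱχ D σ)

/-- ★★ **SELF-CHARGING**: `farResidue ≤ κ·(shellMassL + transMassL) + bulkFarResidue` with the sharp tail constant `κ` at `R = 3ϱ/8`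
(`0 < s ≤ 3ϱ/8`, `1 ≤ 3ϱ/8`, any shell thickness `h > 0`): every source in the profile shell or with a listed set in transition pays its own
far residue out of its own carrier mass. -/
theorem farResidue_le_selfCharge {P : PeriodicConfiguration 3} (X : Set E3) (ϱ : ℝ) (C : Set E3) {s : ℝ} (hP : IsSeparatedRef s P)
    (hs : 0 < s) (hϱ1 : 1 ≤ 3 * ϱ / 8) (hsϱ : s ≤ 3 * ϱ / 8) {h : ℝ} (hh : 0 < h) :
    farResidue ϱχ D σ P X ϱ C ≤
      (2 * h / s + 2) * (2 / s) ^ 2 * ((3 * ϱ / 8 + h + s / 2) / (3 * ϱ / 8)) ^ 2 * (3 / (3 * ϱ / 8) ^ 4 + 1 / (h * (3 * ϱ / 8) ^ 3)) *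
          (shellMassL ϱχ D σ P X ϱ C + transMassL ϱχ D σ P X ϱ C) +
        bulkFarResidue ϱχ D σ P X ϱ C := by
  set κ : ℝ := (2 * h / s + 2) * (2 / s) ^ 2 * ((3 * ϱ / 8 + h + s / 2) / (3 * ϱ / 8)) ^ 2 *
    (3 / (3 * ϱ / 8) ^ 4 + 1 / (h * (3 * ϱ / 8) ^ 3)) with hκ
  have hκ0 : 0 ≤ κ := (sharpTailConst_pos hs hh (by linarith : (0 : ℝ) < 3 * ϱ / 8)).le
  set Y : Set E3 := X \ nearZone ϱχ D σ P X ϱ C with hY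
  unfold farResidue tensionMassL shellMassL transMassL bulkFarResidue
  rw [← Finset.sum_add_distrib, Finset.mul_sum, ← Finset.sum_add_distrib]
  refine Finset.sum_le_sum fun y hy => ?_
  have hyP : y ∈ P.points := P.mem_points_of_mem_motif hy
  have hχ0 := localFactor_nonneg (ϱχ := ϱχ) (D := D) (σ := σ) y
  have ha0 := aliveFactor_nonneg (ϱχ := ϱχ) (D := D) (σ := σ) y
  have hw0 := profileWeight_nonneg ϱ C y
  have hE0 := excisionSum_nonneg P (X \ nearZone ϱχ D σ P X ϱ C) y
  by_cases hyX : y ∈ X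
  · rw [if_pos hyX, if_neg (fun h => h.1 hyX), if_pos hyX, if_neg (fun h => h.1 hyX)]
    simp
  rw [if_neg hyX, if_neg hyX]
  have hS : (if y ∉ X ∧ 0 < profileWeight ϱ C y ∧ profileWeight ϱ C y < 1 then localFactor ϱχ D σ y else 0) =
      (if 0 < profileWeight ϱ C y ∧ profileWeight ϱ C y < 1 then localFactor ϱχ D σ y else 0) := by simp [hyX]
  have hB : (if y ∉ X ∧ profileWeight ϱ C y = 1 ∧ transMult ϱχ D y = 0 then
        localFactor ϱχ D σ y * excisionSum P (X \ nearZone ϱχ D σ P X ϱ C) y else 0) =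
      (if profileWeight ϱ C y = 1 ∧ transMult ϱχ D y = 0 then localFactor ϱχ D σ y else 0) *
        excisionSum P (X \ nearZone ϱχ D σ P X ϱ C) y := by
    simp only [hyX, not_false_eq_true, true_and]
    split_ifs <;> simp
  rw [hS, hB]
  have hsplit := weight_le_shell_add_trans_add_bulk (ϱχ := ϱχ) (D := D) (σ := σ) ϱ C y
  have hS0 : 0 ≤ (if 0 < profileWeight ϱ C y ∧ profileWeight ϱ C y < 1 then localFactor ϱχ D σ y else 0) := by
    split_ifs <;> linarith
  have hT0 : 0 ≤ profileWeight ϱ C y * aliveFactor ϱχ D σ y * (transMult ϱχ D y : ℝ) ^ 2 := by positivity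
  have hB0 : 0 ≤ (if profileWeight ϱ C y = 1 ∧ transMult ϱχ D y = 0 then localFactor ϱχ D σ y else 0) := by
    split_ifs <;> linarith
  by_cases hpos : 0 < localFactor ϱχ D σ y * profileWeight ϱ C y
  · have hE : excisionSum P (X \ nearZone ϱχ D σ P X ϱ C) y ≤ κ := by
      rw [hκ]; exact excisionSum_far_le_sharp hP hs hϱ1 hsϱ hh hyP hyX hpos
    calc localFactor ϱχ D σ y * (profileWeight ϱ C y * excisionSum P (X \ nearZone ϱχ D σ P X ϱ C) y)
        = (localFactor ϱχ D σ y * profileWeight ϱ C y) * excisionSum P (X \ nearZone ϱχ D σ P X ϱ C) y := by ring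
      _ ≤ ((if 0 < profileWeight ϱ C y ∧ profileWeight ϱ C y < 1 then localFactor ϱχ D σ y else 0) +
            profileWeight ϱ C y * aliveFactor ϱχ D σ y * (transMult ϱχ D y : ℝ) ^ 2 +
            (if profileWeight ϱ C y = 1 ∧ transMult ϱχ D y = 0 then localFactor ϱχ D σ y else 0)) *
            excisionSum P (X \ nearZone ϱχ D σ P X ϱ C) y := mul_le_mul_of_nonneg_right hsplit hE0
      _ ≤ _ := by nlinarith [mul_le_mul_of_nonneg_left hE (add_nonneg hS0 hT0)]
  · have hzero : localFactor ϱχ D σ y * profileWeight ϱ C y = 0 :=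
      le_antisymm (not_lt.1 hpos) (mul_nonneg hχ0 hw0)
    calc localFactor ϱχ D σ y * (profileWeight ϱ C y * excisionSum P (X \ nearZone ϱχ D σ P X ϱ C) y)
        = (localFactor ϱχ D σ y * profileWeight ϱ C y) * excisionSum P (X \ nearZone ϱχ D σ P X ϱ C) y := by ring
      _ = 0 := by rw [hzero, zero_mul]
      _ ≤ _ := by positivity

/-- ★ At the record separation `s = 3/5` and profile scale `ϱ = 160` (far threshold `60`): `farResidue ≤ (1/3800)·(shellMassL + transMassL)
+ bulkFarResidue`. -/
theorem farResidue_le_selfCharge_record {P : PeriodicConfiguration 3} (X : Set E3) (C : Set E3) (hP : IsSeparatedRef (3 / 5) P) :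
    farResidue ϱχ D σ P X 160 C ≤ 1 / 3800 * (shellMassL ϱχ D σ P X 160 C + transMassL ϱχ D σ P X 160 C) + bulkFarResidue ϱχ D σ P X 160 C := by
  have h := farResidue_le_selfCharge ϱχ D σ X 160 C hP (by norm_num) (by norm_num) (by norm_num) (h := 12 / 5) (by norm_num)
  have hκ : (2 * (12 / 5 : ℝ) / (3 / 5) + 2) * (2 / (3 / 5)) ^ 2 * ((3 * 160 / 8 + 12 / 5 + (3 / 5) / 2) / (3 * 160 / 8)) ^ 2 *
      (3 / (3 * 160 / 8) ^ 4 + 1 / ((12 / 5) * (3 * 160 / 8) ^ 3)) ≤ 1 / 3800 := by norm_num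
  have hM := add_nonneg (shellMassL_nonneg ϱχ D σ P X 160 C) (transMassL_nonneg ϱχ D σ P X 160 C)
  nlinarith [mul_le_mul_of_nonneg_right hκ hM]

end SelfChargeMain

section BulkBound

variable (ϱχ ϱ : ℝ)

/-- piece BULK-FAR-RESIDUE(`B_T`, `B_χ`, `B_H`) · UNDECIDED→TRUE-leaning at the record `(B_T, B_χ) = (1/2100, 1/46)`, `B_H` free · ATTACKABLE·M ·
PURELY GEOMETRIC (as `FarResidueBound`, P-Y).  **THE BULK FAR-RESIDUE BOUND** with constants `(B_T, B_χ, B_H)`: the far residue emitted by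
the BULK sources of every instance is paid by the three currencies — the residual of `FarResidueBound` after self-charging
(`farResidueBound_of_bulk`).  Why it might fail / content: the segment (tube) charging of seat HANDOFF §E (B) — a bulk source lies inside
the paying region with all profile factors equal to `1`, a far excised site has no paying site within `3ϱ/8`, so the segment between them
crosses a full boundary layer of the paying region (profile shell of thickness `ϱ/2`, a transition layer of thickness `ϱχ/2`, or priced
excised material of thickness `3ϱ/8`), whose sites (P-Z₁: no hole of radius `> 219/100`) are the carriers; the load per carrier is a
convergent pair integral (HANDOFF §D/§E (L)); a funnel geometry overloading few transition carriers is the risk. -/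
def BulkFarResidueBound (s lam ℓ ϱ ϱχ B_T B_χ B_H : ℝ) : Prop :=
  ∀ (P : PeriodicConfiguration 3) (C X : Set E3) (m : ℕ) (D : Fin m → Set E3) (σ : Fin m → Bool),
    IsSeparatedRef s P → IsLabelledRef lam ℓ P → IsInvariantSet P C → IsInvariantSet P X → (∀ i, IsInvariantSet P (D i)) →
    bulkFarResidue ϱχ D σ P X ϱ C ≤
      B_T * shellMassL ϱχ D σ P X ϱ C + B_χ * transMassL ϱχ D σ P X ϱ C + B_H * (pricedNearCountL ϱχ D σ P X ϱ C : ℝ)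

variable {s lam ℓ : ℝ} {ϱχ ϱ}

/-- ★★ **BULK BOUND ⟹ FAR-RESIDUE BOUND** (self-charging absorbs the carrier-type sources into the constants): for `0 < s ≤ 3ϱ/8`, `1 ≤ 3ϱ/8`
and any shell thickness `h > 0`, `BulkFarResidueBound … B_T B_χ B_H ⟹ FarResidueBound … (B_T + κ) (B_χ + κ) B_H`. -/
theorem farResidueBound_of_bulk {B_T B_χ B_H : ℝ} (hs : 0 < s) (hϱ1 : 1 ≤ 3 * ϱ / 8) (hsϱ : s ≤ 3 * ϱ / 8) {h : ℝ} (hh : 0 < h)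
    (hB : BulkFarResidueBound s lam ℓ ϱ ϱχ B_T B_χ B_H) :
    FarResidueBound s lam ℓ ϱ ϱχ
      (B_T + (2 * h / s + 2) * (2 / s) ^ 2 * ((3 * ϱ / 8 + h + s / 2) / (3 * ϱ / 8)) ^ 2 * (3 / (3 * ϱ / 8) ^ 4 + 1 / (h * (3 * ϱ / 8) ^ 3)))
      (B_χ + (2 * h / s + 2) * (2 / s) ^ 2 * ((3 * ϱ / 8 + h + s / 2) / (3 * ϱ / 8)) ^ 2 * (3 / (3 * ϱ / 8) ^ 4 + 1 / (h * (3 * ϱ / 8) ^ 3)))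
      B_H := by
  intro P C X m D σ hsep hlab hC hX hD
  have h1 := farResidue_le_selfCharge ϱχ D σ X ϱ C hsep hs hϱ1 hsϱ hh
  have h2 := hB P C X m D σ hsep hlab hC hX hD
  nlinarith [shellMassL_nonneg ϱχ D σ P X ϱ C, transMassL_nonneg ϱχ D σ P X ϱ C]

/-- ★ THE RECORD COMPOSITION: `BulkFarResidueBound (3/5) (1/3) 3 160 80 B_T B_χ B_H ⟹ FarResidueBound (3/5) (1/3) 3 160 80 (B_T + 1/3800)
(B_χ + 1/3800) B_H`. -/
theorem farResidueBound_record_of_bulk {B_T B_χ B_H : ℝ} (hB : BulkFarResidueBound (3 / 5) (1 / 3) 3 160 80 B_T B_χ B_H) :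
    FarResidueBound (3 / 5) (1 / 3) 3 160 80 (B_T + 1 / 3800) (B_χ + 1 / 3800) B_H := by
  have h := farResidueBound_of_bulk (ϱχ := 80) (ϱ := 160) (by norm_num) (by norm_num) (by norm_num) (h := 12 / 5) (by norm_num) hB
  have hκ : (2 * (12 / 5 : ℝ) / (3 / 5) + 2) * (2 / (3 / 5)) ^ 2 * ((3 * 160 / 8 + 12 / 5 + (3 / 5) / 2) / (3 * 160 / 8)) ^ 2 *
      (3 / (3 * 160 / 8) ^ 4 + 1 / ((12 / 5) * (3 * 160 / 8) ^ 3)) ≤ 1 / 3800 := by norm_num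
  exact h.mono (by linarith) (by linarith) le_rfl

/-- ★★ **NODE 63′ — THE ROTATION SUB-FAMILY OF (H𝄪ˢ) FROM THE BULK BOUND ALONE**: at the record dials, `BulkFarResidueBound (3/5) (1/3) 3 160 80
(1/2100) (1/46) B_H` (any `B_H ≥ 0`) gives `RotationFamilyS (3/5) (1/3) 3 (1/100) (3/100) (1/2) 160 (2/5) 3 (1/3000000) 80 (1/100000)`
(`1/2100 + 1/3800 ≤ 1/1350 = C_T/(λτ²)`, `1/46 + 1/3800 ≤ 1/45 = Cχ/(λτ²)`). -/
theorem rotationFamilyS_record_of_bulkBound {B_H : ℝ} (hBH : 0 ≤ B_H)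
    (hB : BulkFarResidueBound (3 / 5) (1 / 3) 3 160 80 (1 / 2100) (1 / 46) B_H) :
    RotationFamilyS (3 / 5) (1 / 3) 3 (1 / 100) (3 / 100) (1 / 2) 160 (2 / 5) 3 (1 / 3000000) 80 (1 / 100000) :=
  rotationFamilyS_record_of_farResidueBound hBH
    ((farResidueBound_record_of_bulk hB).mono (by norm_num) (by norm_num) le_rfl)

/-- Record numerals of the self-charging: the sharp tail `1/3800` against the budgets, and the bulk budgets it leaves. -/
theorem record_selfCharge_numerals :
    (1 : ℝ) / 2100 + 1 / 3800 ≤ 1 / 1350 ∧ (1 : ℝ) / 46 + 1 / 3800 ≤ 1 / 45 ∧ (1 : ℝ) / 3000000 / ((1 / 2) * (3 / 100) ^ 2) = 1 / 1350 ∧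
      (1 : ℝ) / 100000 / ((1 / 2) * (3 / 100) ^ 2) = 1 / 45 ∧ (3 : ℝ) * 160 / 8 = 60 := by
  refine ⟨by norm_num, by norm_num, by norm_num, by norm_num, by norm_num⟩

end BulkBound

end Summit.AtomisticToContinuum.Crystallization.Theorems.ChargedEnergyGapChartDial

end
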